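import Literature.Barriers.RiemannHypothesis.MollifierLimitationsPropBQuadFormProofs
import HarnessLib

/-!
# Radziwiłł 2012, §7: Soundararajan's bound for the quadratic form at a rescaled height

`Literature/Barriers/RiemannHypothesis/MollifierLimitationsPropBQuadFormProofs.lean` proves
`𝒬_T(a) ≥ 1 + 1/θ − ε` for `N = ⌊T^θ⌋`, `θ < 1`, `a(1) = 1` (Radziwiłł, *Limitations to mollifying
ζ(s)*, arXiv:1207.6583, §7), where
`𝒬_T(a) = ∑ a(m)ā(n)/[m,n]·(log(T(m,n)²/(2πmn)) + 2log 2 + 2γ − 1)` (`bchQuadForm T N a`).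
The constant `2 log 2 − 1 = T⁻¹∫_T^{2T} log(t/T) dt` is the average of `log t − log T` over the
dyadic interval, and a smoothly weighted mean square over `[T, 2T]` produces instead the
pointwise kernel `log(t(m,n)²/(2πmn)) + 2γ`, i.e. the form `𝒬_{et/4}(a)` (`log(et/4) + 2log2 − 1 = log t`).
This file records the same lower bound for the rescaled height, uniformly in `t ≥ T`:

* `Literature.Barriers.RiemannHypothesis.PropB.bchQuadForm_scaled_ge` — for `0 < θ < 1`, `ε > 0`
  there is `T₀` with `bchQuadForm T' ⌊T^θ⌋ a ≥ 1 + 1/θ − ε` for all `T ≥ T₀`, all real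
  `T' ≥ eT/4` and all `a` with `a(1) = 1`.

The proof is the assembly of `PropB.Radziwill2012_propB_quadForm_holds` verbatim, with
`L_{T'} ≥ log T + 2γ − log 2π` in place of `L_T = log T + 2log 2 + 2γ − 1 − log 2π` (both exceed
`(log N)/θ − 1`, which is all the argument uses).

## References

* [Radziwill2012] M. Radziwiłł, *Limitations to mollifying ζ(s)*, arXiv:1207.6583 (2012), §7,
  p. 12 (displays (7.3)–(7.5)).
-/

noncomputable section

open Finset ArithmeticFunction Complex Filter Real
open scoped ArithmeticFunction.Moebius ArithmeticFunction.zeta ComplexConjugate Topology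

namespace Literature.Barriers.RiemannHypothesis

namespace PropB

/-- `κ' = 2γ − log(2π) > −1` (numerically `κ' ≈ −0.68`). [folklore] -/
theorem neg_one_lt_kappa' : -1 < 2 * Real.eulerMascheroniConstant - Real.log (2 * π) := by
  have hγ := Real.one_half_lt_eulerMascheroniConstant
  have he1 := Real.exp_one_gt_d9
  have hπ := Real.pi_lt_d2
  have hexp2 : (7.3 : ℝ) < Real.exp 2 := by
    have : Real.exp 2 = Real.exp 1 * Real.exp 1 := by rw [← Real.exp_add]; norm_num
    rw [this]; nlinarith
  have hlogπ : Real.log (2 * π) < 2 := by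
    rw [Real.log_lt_iff_lt_exp (by positivity)]
    linarith
  linarith

/-- `L_{T'} ≥ log T + 2γ − log 2π` for `T' ≥ eT/4`, `T > 0`. [folklore] -/
theorem LT_ge_of_le {T T' : ℝ} (hT : 0 < T) (hT' : Real.exp 1 * T / 4 ≤ T') :
    Real.log T + (2 * Real.eulerMascheroniConstant - Real.log (2 * π)) ≤ LT T' := by
  have hT'0 : 0 < T' := lt_of_lt_of_le (by positivity) hT'
  have h1 : Real.log (Real.exp 1 * T / 4) ≤ Real.log T' := Real.log_le_log (by positivity) hT'
  have h2 : Real.log (Real.exp 1 * T / 4) = 1 + Real.log T - 2 * Real.log 2 := by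
    rw [Real.log_div (by positivity) (by norm_num), Real.log_mul (Real.exp_pos 1).ne' hT.ne',
      Real.log_exp, show (4 : ℝ) = 2 ^ 2 by norm_num, Real.log_pow]
    push_cast; ring
  rw [LT]
  linarith

/-- **Soundararajan's bound at the rescaled height.** For `0 < θ < 1` and `ε > 0` there is `T₀`
such that `bchQuadForm T' ⌊T^θ⌋ a ≥ 1 + 1/θ − ε` for all `T ≥ T₀`, all `T' ≥ eT/4` and all
`a : ℕ → ℂ` with `a(1) = 1`. [cite: Radziwill2012, Proposition B and §7] -/
theorem bchQuadForm_scaled_ge {θ : ℝ} (hθ : 0 < θ) (hθ1 : θ < 1) {ε : ℝ} (hε : 0 < ε) :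
    ∃ T₀ : ℝ, ∀ T : ℝ, T₀ ≤ T → ∀ T' : ℝ, Real.exp 1 * T / 4 ≤ T' →
      ∀ a : ℕ → ℂ, a 1 = 1 → 1 + 1 / θ - ε ≤ bchQuadForm T' ⌊T ^ θ⌋₊ a := by
  -- constants
  obtain ⟨CG, hCG0, hCG⟩ := exists_abs_Gs_sub_log_le
  obtain ⟨Cρ, hCρ0, hCρ⟩ := exists_abs_rho_add_le
  obtain ⟨C₇, hC₇0, hC₇⟩ := exists_main_term_ge
  obtain ⟨κ, hκ⟩ : ∃ κ : ℝ, κ = 2 * Real.eulerMascheroniConstant - Real.log (2 * π) := ⟨_, rfl⟩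
  have hκlo : -1 < κ := by rw [hκ]; exact neg_one_lt_kappa'
  obtain ⟨c, hc⟩ : ∃ c : ℝ, c = (1 / θ - 1) / 2 := ⟨_, rfl⟩
  have hθ' : 1 < 1 / θ := by rw [lt_div_iff₀ hθ]; linarith
  have hcpos : 0 < c := by rw [hc]; linarith
  have hε4 : 0 < ε / 4 := by linarith
  -- thresholds in `L = log N`
  obtain ⟨L₁, hL₁⟩ := exists_ratio_ge hθ κ hCG0 hε4
  obtain ⟨L₂, hL₂⟩ := exists_add_log_le_mul hcpos (18 - κ + 12)
  obtain ⟨L₃, hL₃⟩ := exists_err_le hcpos Cρ hε4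
  obtain ⟨Lstar, hLstar⟩ : ∃ Lstar : ℝ,
      Lstar = max (max (max L₁ L₂) (max L₃ (4 * C₇ / ε))) (max (2 * CG + 2) 2) := ⟨_, rfl⟩
  have hLs1 : L₁ ≤ Lstar := by rw [hLstar]; simp only [le_max_iff, le_refl, true_or]
  have hLs2 : L₂ ≤ Lstar := by rw [hLstar]; simp only [le_max_iff, le_refl, true_or, or_true]
  have hLs3 : L₃ ≤ Lstar := by rw [hLstar]; simp only [le_max_iff, le_refl, true_or, or_true]
  have hLs4 : 4 * C₇ / ε ≤ Lstar := by rw [hLstar]; simp only [le_max_iff, le_refl, true_or, or_true]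
  have hLs5 : 2 * CG + 2 ≤ Lstar := by rw [hLstar]; simp only [le_max_iff, le_refl, true_or, or_true]
  have hLs6 : 2 ≤ Lstar := by rw [hLstar]; simp only [le_max_iff, le_refl, or_true]
  -- `N*` and `T₀`
  obtain ⟨Nstar, hNstar⟩ : ∃ Nstar : ℕ, Nstar = ⌈Real.exp Lstar⌉₊ + 3 := ⟨_, rfl⟩
  refine ⟨((Nstar : ℝ) + 1) ^ (1 / θ), fun T hT T' hT' a ha => ?_⟩
  obtain ⟨N, hNdef⟩ : ∃ N : ℕ, N = ⌊T ^ θ⌋₊ := ⟨_, rfl⟩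
  rw [← hNdef]
  -- `T > 0`, `N ≥ N*`
  have hNs0 : (0 : ℝ) < (Nstar : ℝ) + 1 := by positivity
  have hT1 : 1 ≤ T := by
    refine le_trans ?_ hT
    exact Real.one_le_rpow (by linarith) (by positivity)
  have hT0 : 0 < T := by linarith
  have hT'0 : 0 < T' := lt_of_lt_of_le (by positivity) hT'
  have hTθ : (Nstar : ℝ) + 1 ≤ T ^ θ := by
    have h := Real.rpow_le_rpow (by positivity) hT hθ.le
    rwa [← Real.rpow_mul hNs0.le, one_div_mul_cancel hθ.ne', Real.rpow_one] at h
  have hNge : Nstar ≤ N := by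
    rw [hNdef]
    apply Nat.le_floor
    linarith
  have hN3 : 3 ≤ N := le_trans (by rw [hNstar]; omega) hNge
  have hN1 : 1 ≤ N := by omega
  have hNpos : (0 : ℝ) < N := by exact_mod_cast (show 0 < N by omega)
  -- `L = log N ≥ L*`
  obtain ⟨L, hL⟩ : ∃ L : ℝ, L = Real.log N := ⟨_, rfl⟩
  have hLge : Lstar ≤ L := by
    have h1 : Real.exp Lstar ≤ Nstar := by
      rw [hNstar]; push_cast
      have := Nat.le_ceil (Real.exp Lstar)
      linarith
    have h2 : (Nstar : ℝ) ≤ N := by exact_mod_cast hNge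
    rw [hL, ← Real.log_exp Lstar]
    exact Real.log_le_log (Real.exp_pos _) (h1.trans h2)
  have hL1' : L₁ ≤ L := hLs1.trans hLge
  have hL2' : L₂ ≤ L := hLs2.trans hLge
  have hL3' : L₃ ≤ L := hLs3.trans hLge
  have hL4' : 4 * C₇ / ε ≤ L := hLs4.trans hLge
  have hL5' : 2 * CG + 2 ≤ L := hLs5.trans hLge
  have hL2 : 2 ≤ L := hLs6.trans hLge
  have hLpos : 0 < L := by linarith
  -- `log T ≥ L/θ` and `L_{T'} ≥ L/θ + κ`
  have hlogT : L / θ ≤ Real.log T := by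
    rw [div_le_iff₀ hθ]
    have hNT : (N : ℝ) ≤ T ^ θ := by
      rw [hNdef]; exact Nat.floor_le (by positivity)
    have := Real.log_le_log hNpos hNT
    rwa [Real.log_rpow hT0, mul_comm, ← hL] at this
  have hLT : 1 / θ * L + κ ≤ LT T' := by
    have h := LT_ge_of_le hT0 hT'
    rw [← hκ] at h
    rw [one_div_mul_eq_div]; linarith
  -- `G`
  have hGb := Gs_bounds (fun n hn => (hCG n hn)) hN1
  rw [← hL] at hGb
  have hG1 := one_le_Gs hN1
  have hGpos : 0 < Gs N := by linarith
  have hGlo : L / 2 ≤ Gs N := by linarith [hGb.1]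
  have hGup : Gs N ≤ L + 1 + CG := hGb.2
  -- `A ≥ c L`
  obtain ⟨A, hAdef⟩ : ∃ A : ℝ, A = LT T' - Real.log N - 6 - 4 * (Real.log (Real.log N) + 3) :=
    ⟨_, rfl⟩
  have hAge : c * L ≤ A := by
    have h := hL₂ L hL2'
    rw [hAdef, ← hL]
    have h1 : (1 / θ - 1) * L + κ ≤ LT T' - L := by nlinarith [hLT]
    have h2 : (1 / θ - 1) * L = 2 * (c * L) := by rw [hc]; ring
    linarith
  have hApos : 0 < A := lt_of_lt_of_le (by positivity) hAge
  -- the core bound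
  have core := bchQuadForm_ge_core hN3 hT'0 a ha hCρ0 (hCρ N hN3) (hC₇ N hN3) hAdef hApos
  rw [← hL] at core
  -- (e1) `L_{T'}/G ≥ 1/θ − ε/4`
  have e1 : 1 / θ - ε / 4 ≤ LT T' / Gs N := by
    have h := hL₁ L hL1'
    refine h.trans ?_
    have hnum : 0 ≤ 1 / θ * L + κ := by nlinarith
    calc (1 / θ * L + κ) / (L + 1 + CG) ≤ (1 / θ * L + κ) / Gs N :=
          div_le_div_of_nonneg_left hnum hGpos hGup
      _ ≤ LT T' / Gs N := div_le_div_of_nonneg_right hLT hGpos.le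
  -- (e2) `C₇/log N ≤ ε/4`
  have e2 : C₇ / L ≤ ε / 4 := by
    rw [div_le_iff₀ hLpos]
    rw [div_le_iff₀ hε] at hL4'
    linarith
  -- (e3) `K²/(AG) ≤ ε/4`
  have e3 : (Cρ + Real.log L) ^ 2 / (A * Gs N) ≤ ε / 4 := by
    have h := hL₃ L hL3'
    refine le_trans ?_ h
    apply div_le_div_of_nonneg_left (by positivity) (by positivity)
    exact mul_le_mul hAge hGlo (by positivity) hApos.le
  linarith

/-- **The pointwise form on a dyadic interval**: for `0 < θ < 1`, `ε > 0` there is `T₀` such that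
`bchQuadForm (e t/4) ⌊T^θ⌋ a ≥ 1 + 1/θ − ε` for all `T ≥ T₀`, all `t ≥ T` and all `a` with
`a(1) = 1` — the kernel of `bchQuadForm (et/4)` being `log(t(m,n)²/(2πmn)) + 2γ`.
[cite: Radziwill2012, Proposition B and §7] -/
theorem bchQuadForm_pointwise_ge {θ : ℝ} (hθ : 0 < θ) (hθ1 : θ < 1) {ε : ℝ} (hε : 0 < ε) :
    ∃ T₀ : ℝ, ∀ T : ℝ, T₀ ≤ T → ∀ t : ℝ, T ≤ t →
      ∀ a : ℕ → ℂ, a 1 = 1 → 1 + 1 / θ - ε ≤ bchQuadForm (Real.exp 1 * t / 4) ⌊T ^ θ⌋₊ a := by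
  obtain ⟨T₀, h⟩ := bchQuadForm_scaled_ge hθ hθ1 hε
  refine ⟨T₀, fun T hT t ht a ha => h T hT _ ?_ a ha⟩
  have : 0 < Real.exp 1 := Real.exp_pos 1
  nlinarith

/-- The kernel identity behind the rescaling: `log(et/4·g²/(2πmn)) + 2log2 + 2γ − 1
= log(t g²/(2πmn)) + 2γ` (`t, g, m, n > 0`). [folklore] -/
theorem kernel_rescale {t g m n : ℝ} (ht : 0 < t) (hg : 0 < g) (hm : 0 < m) (hn : 0 < n) :
    Real.log (Real.exp 1 * t / 4 * g ^ 2 / (2 * π * m * n)) + 2 * Real.log 2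
        + 2 * Real.eulerMascheroniConstant - 1
      = Real.log (t * g ^ 2 / (2 * π * m * n)) + 2 * Real.eulerMascheroniConstant := by
  have hπ := Real.pi_pos
  have h1 : Real.exp 1 * t / 4 * g ^ 2 / (2 * π * m * n)
      = (Real.exp 1 / 4) * (t * g ^ 2 / (2 * π * m * n)) := by ring
  rw [h1, Real.log_mul (by positivity) (by positivity), Real.log_div (Real.exp_pos 1).ne' (by norm_num),
    Real.log_exp, show (4 : ℝ) = 2 ^ 2 by norm_num, Real.log_pow]
  push_cast; ring

/-- **`bchQuadForm (et/4) N a` is the form with kernel `log(t(m,n)²/(2πmn)) + 2γ`.** [folklore] -/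
theorem bchQuadForm_rescale {t : ℝ} (ht : 0 < t) (N : ℕ) (a : ℕ → ℂ) :
    bchQuadForm (Real.exp 1 * t / 4) N a
      = ∑ m ∈ Icc 1 N, ∑ n ∈ Icc 1 N,
          (a m * conj (a n)).re / (Nat.lcm m n : ℝ) *
            (Real.log (t * (Nat.gcd m n : ℝ) ^ 2 / (2 * π * m * n))
              + 2 * Real.eulerMascheroniConstant) := by
  unfold bchQuadForm
  refine Finset.sum_congr rfl fun m hm => Finset.sum_congr rfl fun n hn => ?_
  have hm0 : (0 : ℝ) < m := by exact_mod_cast (mem_Icc.1 hm).1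
  have hn0 : (0 : ℝ) < n := by exact_mod_cast (mem_Icc.1 hn).1
  have hg0 : (0 : ℝ) < (Nat.gcd m n : ℝ) := by
    exact_mod_cast Nat.gcd_pos_of_pos_left _ (mem_Icc.1 hm).1
  rw [kernel_rescale ht hg0 hm0 hn0]

end PropB

end Literature.Barriers.RiemannHypothesis
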